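import Mathlib
import HarnessLib

/-!
# Firefly Monte Carlo: the auxiliary-variable augmentation with per-factor lower bounds is exact
# (Maclaurin–Adams 2014, §2)

HONEST FRAMING: exact (Metropolis-corrected) sampling algorithms for lattice gauge theory;
figures of merit are autocorrelation/cost numbers at stated couplings and volumes; no
continuum-physics claim.

Topic `Probability/MarkovChains` (exactness of auxiliary-variable / subsampling constructions;
sibling of `DelayedAcceptance.lean`, `HierarchicalMetropolis.lean`).  PUBLISHED RESULT with our
proofs (finite algebra over the `2^N` brightness configurations); no named fact.

Source READ: D. Maclaurin, R. P. Adams, *Firefly Monte Carlo: exact MCMC with subsets of data*,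
UAI 2014 [arXiv:1403.5693] [MaclaurinAdams2014], §2 (held text `paper:arxiv-1403.5693`, chunk
p0004), VERBATIM: "For each data point, `n`, we introduce a binary auxiliary variable
`z_n ∈ {0,1}`, and a function `B_n(θ)` which is a strictly positive lower bound on the `n`th
likelihood: `0 < B_n(θ) ≤ L_n(θ)`. Each `z_n` has the following Bernoulli distribution conditioned
on the parameters: `p(z_n | x_n, θ) = [(L_n(θ) − B_n(θ))/L_n(θ)]^{z_n} [B_n(θ)/L_n(θ)]^{1−z_n}` …
augmenting the joint distribution in this way does not damage the original marginal distribution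
of interest: `Σ_{z_1} ⋯ Σ_{z_N} p(θ) Π_n p(x_n|θ) p(z_n|x_n,θ) = p(θ) Π_n p(x_n|θ) Σ_{z_n}
p(z_n|x_n,θ) = p(θ) Π_n p(x_n|θ)` … `p(x_n|θ) p(z_n|x_n,θ) = L_n(θ) − B_n(θ)` if `z_n = 1`,
`B_n(θ)` if `z_n = 0` … `p(θ, {z_n} | {x_n}) ∝ p̃(θ) Π_{n : z_n = 1} L̃_n(θ)` where
`p̃(θ) = p(θ) Π_n B_n(θ)`, `L̃_n(θ) = (L_n(θ) − B_n(θ))/B_n(θ)`"; §3.1: "the average number of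
bright data points will be `M = Σ_n ⟨z_n⟩ = Σ_n ∫ p(θ|{x_n}) (L_n(θ) − B_n(θ))/L_n(θ) dθ`".

Lean reading: a finite index type `ι` of data (factors), a parameter `θ : Θ` (any type), prior
weight `p θ`, factors `L n θ` with lower bounds `B n θ`; a brightness configuration is
`z : ι → Bool`; `jointWeight p L B θ z = p θ · Π_n (L_n θ − B_n θ if z_n else B_n θ)` is the
augmented (unnormalised) density.

Contents (all proved).
* **`sum_jointWeight`** — the MARGINAL IS EXACT: `Σ_{z : ι → Bool} jointWeight θ z = p θ Π_n L_n θ`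
  (no hypothesis on `B` is needed for the identity itself). [MaclaurinAdams2014, §2]
* **`jointWeight_nonneg`** — it is a DENSITY iff the bounds hold: `0 ≤ jointWeight θ z` for all `z`
  when `0 ≤ p`, `0 ≤ B_n ≤ L_n`; and `exists_jointWeight_neg` — if some `B_n θ > L_n θ` (with
  `p θ > 0`, the other bounds positive) then the all-dark-but-`n` configuration has NEGATIVE weight,
  i.e. the "lower bound" requirement is necessary for exactness-as-a-probability. [§2: "strictly
  positive lower bound … `0 < B_n(θ) ≤ L_n(θ)`"]
* **`jointWeight_eq_pseudo`** — the pseudo-prior / pseudo-likelihood form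
  `jointWeight θ z = (p θ Π_n B_n θ) · Π_{n : z_n} (L_n θ − B_n θ)/B_n θ` (`B_n θ ≠ 0`): only the
  BRIGHT factors' true likelihoods are evaluated. [§2 eq. (JointDist)]
* `brightProb`, **`sum_brightProb`** — the conditional law of `z_n` given `θ` is Bernoulli with
  success probability `(L_n − B_n)/L_n`, so the expected number of bright points given `θ` is
  `Σ_n (L_n θ − B_n θ)/L_n θ` (the integrand of §3.1's `M`). [§3.1]

Context (cell pub-lqcd, HOME/R2-SCOPE.md §3/§5, the planted INVALID-4 control): an "exact"
subsampling of the factors of a product weight (data terms there; determinant / pseudofermion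
factors here) by auxiliary Bernoulli variables is exact ONLY with certified positive lower bounds
on every factor — the same shape of requirement as the positivity needed by Bernoulli-factory /
pseudo-marginal exactness (`NonnegativeUnbiasedEstimators.lean`).
-/

namespace Literature.Probability.MarkovChains

namespace Firefly

open Finset

variable {ι Θ : Type*} [Fintype ι] [DecidableEq ι]

/-- The factor of data point `n` in the augmented density: `L_n(θ) − B_n(θ)` if bright (`z_n = 1`),
`B_n(θ)` if dark. [cite: MaclaurinAdams2014, §2 (display "`= L_n(θ) − B_n(θ)` if `z_n = 1`,
`B_n(θ)` if `z_n = 0`")] -/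
def factor (L B : ι → Θ → ℝ) (θ : Θ) (z : ι → Bool) (n : ι) : ℝ :=
  if z n then L n θ - B n θ else B n θ

/-- The augmented (unnormalised) joint density `p(θ) Π_n p(x_n|θ) p(z_n|x_n,θ)
= p(θ) Π_n factor_n`. [cite: MaclaurinAdams2014, §2 (the augmented posterior)] -/
def jointWeight (p : Θ → ℝ) (L B : ι → Θ → ℝ) (θ : Θ) (z : ι → Bool) : ℝ :=
  p θ * ∏ n, factor L B θ z n

/-- **THE MARGINAL OVER THE BRIGHTNESS VARIABLES IS THE ORIGINAL TARGET**:
`Σ_{z} p(θ) Π_n factor_n(z) = p(θ) Π_n L_n(θ)` ("augmenting the joint distribution in this way does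
not damage the original marginal distribution of interest"). [cite: MaclaurinAdams2014, §2 (the
three-line display `Σ_{z_1} ⋯ Σ_{z_N} … = p(θ) Π_n p(x_n|θ)`)] -/
theorem sum_jointWeight (p : Θ → ℝ) (L B : ι → Θ → ℝ) (θ : Θ) :
    ∑ z : ι → Bool, jointWeight p L B θ z = p θ * ∏ n, L n θ := by
  unfold jointWeight
  rw [← mul_sum]
  congr 1
  -- `Π_n ((L_n − B_n) + B_n) = Σ_z Π_n factor_n(z)` (expand the product over the two summands)
  have h := Finset.prod_univ_sum (fun (_ : ι) => (univ : Finset Bool))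
    (fun n b => if b = true then L n θ - B n θ else B n θ)
  simp only [Fintype.piFinset_univ, Fintype.sum_bool, ↓reduceIte, Bool.false_eq_true] at h
  rw [show (∏ n, L n θ) = ∏ n, ((L n θ - B n θ) + B n θ) by simp, h]
  rfl

omit [DecidableEq ι] in
/-- **IT IS A DENSITY WHEN THE BOUNDS HOLD**: `0 ≤ B_n ≤ L_n` and `0 ≤ p` give a non-negative
augmented weight for every brightness configuration. [cite: MaclaurinAdams2014, §2 ("`B_n(θ)` … a
strictly positive lower bound on the `n`th likelihood: `0 < B_n(θ) ≤ L_n(θ)`")] -/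
theorem jointWeight_nonneg {p : Θ → ℝ} {L B : ι → Θ → ℝ} {θ : Θ} (hp : 0 ≤ p θ)
    (hB : ∀ n, 0 ≤ B n θ) (hBL : ∀ n, B n θ ≤ L n θ) (z : ι → Bool) :
    0 ≤ jointWeight p L B θ z := by
  unfold jointWeight
  refine mul_nonneg hp (prod_nonneg fun n _ => ?_)
  unfold factor
  split_ifs
  · linarith [hBL n]
  · exact hB n

/-- **THE LOWER BOUND IS NECESSARY**: if some `B_m(θ) > L_m(θ)` while `p(θ) > 0` and the other
bounds are positive, the configuration with only `m` bright has NEGATIVE augmented weight — the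
augmentation is then not a probability distribution, and "exactness" is void.
[cite: MaclaurinAdams2014, §2 (the requirement `0 < B_n(θ) ≤ L_n(θ)`)] -/
theorem exists_jointWeight_neg {p : Θ → ℝ} {L B : ι → Θ → ℝ} {θ : Θ} (hp : 0 < p θ)
    (hB : ∀ n, 0 < B n θ) {m : ι} (hm : L m θ < B m θ) :
    ∃ z : ι → Bool, jointWeight p L B θ z < 0 := by
  classical
  refine ⟨fun n => decide (n = m), ?_⟩
  unfold jointWeight
  refine mul_neg_of_pos_of_neg hp ?_
  rw [← prod_erase_mul _ _ (mem_univ m)]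
  refine mul_neg_of_pos_of_neg (prod_pos fun n hn => ?_) ?_
  · have hne : n ≠ m := (mem_erase.mp hn).1
    simp [factor, hne, hB n]
  · simp [factor]
    linarith

omit [DecidableEq ι] in
/-- **THE PSEUDO-PRIOR / PSEUDO-LIKELIHOOD FORM** (only bright likelihoods are evaluated):
`jointWeight θ z = (p θ Π_n B_n θ) · Π_{n : z_n = 1} (L_n θ − B_n θ)/B_n θ`.
[cite: MaclaurinAdams2014, §2 eq. (JointDist) with `p̃(θ) = p(θ) Π_n B_n(θ)`,
`L̃_n(θ) = (L_n(θ) − B_n(θ))/B_n(θ)`] -/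
theorem jointWeight_eq_pseudo {p : Θ → ℝ} {L B : ι → Θ → ℝ} {θ : Θ} (hB : ∀ n, B n θ ≠ 0)
    (z : ι → Bool) :
    jointWeight p L B θ z =
      (p θ * ∏ n, B n θ) * ∏ n ∈ univ.filter (fun n => z n = true), (L n θ - B n θ) / B n θ := by
  unfold jointWeight
  rw [mul_assoc]
  congr 1
  -- split both products into bright and dark parts
  rw [← prod_filter_mul_prod_filter_not univ (fun n => z n = true) (fun n => factor L B θ z n),
    ← prod_filter_mul_prod_filter_not univ (fun n => z n = true) (fun n => B n θ)]
  have h1 : ∏ n ∈ univ.filter (fun n => z n = true), factor L B θ z n =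
      ∏ n ∈ univ.filter (fun n => z n = true), (L n θ - B n θ) := by
    refine prod_congr rfl fun n hn => ?_
    simp [factor, (mem_filter.mp hn).2]
  have h2 : ∏ n ∈ univ.filter (fun n => ¬ z n = true), factor L B θ z n =
      ∏ n ∈ univ.filter (fun n => ¬ z n = true), B n θ := by
    refine prod_congr rfl fun n hn => ?_
    simp [factor, (mem_filter.mp hn).2]
  rw [h1, h2]
  have h3 : (∏ n ∈ univ.filter (fun n => z n = true), B n θ) *
      ∏ n ∈ univ.filter (fun n => z n = true), (L n θ - B n θ) / B n θ =
        ∏ n ∈ univ.filter (fun n => z n = true), (L n θ - B n θ) := by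
    rw [← prod_mul_distrib]
    exact prod_congr rfl fun n _ => mul_div_cancel₀ _ (hB n)
  rw [← h3]
  ring

/-- The conditional probability that point `n` is bright given `θ`: `(L_n − B_n)/L_n`
("`z_n ∼ Bernoulli(1 − B_n(θ)/L_n(θ))`"). [cite: MaclaurinAdams2014, §2 (`p(z_n | x_n, θ)`),
Algorithm 1 (basic FlyMC)] -/
noncomputable def brightProb (L B : ι → Θ → ℝ) (θ : Θ) (n : ι) : ℝ := (L n θ - B n θ) / L n θ

omit [Fintype ι] [DecidableEq ι] in
/-- `brightProb = 1 − B_n/L_n` (`L_n ≠ 0`). [cite: MaclaurinAdams2014, Algorithm 1 (basic FlyMC)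
("`z_n ∼ Bernoulli(1 − B_n(θ_{i−1})/L_n(θ_{i−1}))`")] -/
theorem brightProb_eq (L B : ι → Θ → ℝ) (θ : Θ) (n : ι) (hL : L n θ ≠ 0) :
    brightProb L B θ n = 1 - B n θ / L n θ := by
  unfold brightProb
  field_simp

omit [Fintype ι] [DecidableEq ι] in
/-- The conditional weight of `z_n` is `L_n · Bernoulli(brightProb)`: `factor_n(z) = L_n θ ·
(brightProb if z_n else 1 − brightProb)` (`L_n ≠ 0`), i.e. `p(x_n|θ) p(z_n|x_n,θ)`.
[cite: MaclaurinAdams2014, §2 (display for `p(x_n|θ) p(z_n|x_n,θ)`)] -/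
theorem factor_eq_mul_bernoulli (L B : ι → Θ → ℝ) (θ : Θ) (z : ι → Bool) (n : ι)
    (hL : L n θ ≠ 0) :
    factor L B θ z n =
      L n θ * (if z n then brightProb L B θ n else 1 - brightProb L B θ n) := by
  unfold factor brightProb
  split_ifs
  · field_simp
  · field_simp
    ring

/-- **EXPECTED NUMBER OF BRIGHT POINTS given `θ`**: `E[#{n : z_n = 1} | θ] = Σ_n (L_n θ − B_n θ)/
L_n θ` (the integrand of §3.1's `M = Σ_n ⟨z_n⟩`), computed from the augmented weights:
`Σ_z jointWeight θ z · #{bright} = p θ (Π_n L_n θ) · Σ_n brightProb_n` (all `L_n θ ≠ 0`).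
[cite: MaclaurinAdams2014, §3.1 (display for `M`)] -/
theorem sum_jointWeight_mul_card (p : Θ → ℝ) (L B : ι → Θ → ℝ) (θ : Θ)
    (hL : ∀ n, L n θ ≠ 0) :
    ∑ z : ι → Bool, jointWeight p L B θ z * ((univ.filter fun n => z n = true).card : ℝ) =
      p θ * (∏ n, L n θ) * ∑ n, brightProb L B θ n := by
  -- `#{bright} = Σ_n 1_{z_n}`; exchange the sums; for fixed `n` the sum over `z` is the marginal
  -- identity `sum_jointWeight` for the modified factors `(L_n − B_n, 0)` at index `n`
  have hcard : ∀ z : ι → Bool, ((univ.filter fun n => z n = true).card : ℝ) =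
      ∑ n, if z n = true then (1 : ℝ) else 0 := by
    intro z
    rw [Finset.card_filter]
    push_cast
    rfl
  simp_rw [hcard, mul_sum, sum_comm (s := (univ : Finset (ι → Bool)))]
  refine sum_congr rfl fun n _ => ?_
  -- modified factors: dark value `0` at index `n`, unchanged elsewhere
  set L' : ι → Θ → ℝ := fun m θ' => if m = n then L n θ' - B n θ' else L m θ' with hL'
  set B' : ι → Θ → ℝ := fun m θ' => if m = n then 0 else B m θ' with hB'
  have hfac : ∀ z : ι → Bool, jointWeight p L B θ z * (if z n = true then (1 : ℝ) else 0) =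
      jointWeight p L' B' θ z := by
    intro z
    unfold jointWeight
    rw [mul_assoc, ← prod_erase_mul _ _ (mem_univ n), ← prod_erase_mul _ _ (mem_univ n)]
    congr 1
    have e1 : ∏ m ∈ univ.erase n, factor L' B' θ z m = ∏ m ∈ univ.erase n, factor L B θ z m :=
      prod_congr rfl fun m hm => by simp [factor, hL', hB', (mem_erase.mp hm).1]
    rw [e1, mul_assoc]
    congr 1
    simp only [factor, hL', hB', if_true]
    split_ifs <;> simp
  simp_rw [hfac]
  rw [sum_jointWeight p L' B' θ, ← prod_erase_mul _ (fun m => L' m θ) (mem_univ n),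
    ← prod_erase_mul _ (fun m => L m θ) (mem_univ n), brightProb]
  have e2 : ∏ m ∈ univ.erase n, L' m θ = ∏ m ∈ univ.erase n, L m θ :=
    prod_congr rfl fun m hm => by simp [hL', (mem_erase.mp hm).1]
  rw [e2]
  simp only [hL', if_true]
  have hLn := hL n
  field_simp

end Firefly

end Literature.Probability.MarkovChains
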